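import Literature.MathematicalPhysics.QuantumLattice.Imbrie2016.ShiftedWindows
import Literature.MathematicalPhysics.QuantumLattice.FinDimSpectrumClusterGapProofs
import Literature.Analysis.InnerProduct.CourantFischerBounds

/-!
# Imbrie (2016), Assumption LLA: the ordered levels of the chain (1.1) are continuous in the couplings;
# the small-gap event is open (hence measurable) and the all-shifts window law holds without a measurability proviso

CITATION HEADER (lean-in-tree rule 2026-08-18). J. Z. Imbrie, *On many-body localization for quantum spin chains*,
J. Stat. Phys. **163** (2016) 998–1048, doi 10.1007/s10955-016-1508-x, arXiv:1403.7837 [ImbrieJSP2016], eq. (1.1) (the box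
Hamiltonian `H γ p` of `LLA.lean`), p. 1000 (admissible laws), eq. (1.3) = (5.2) (Assumption LLA(ν, C): the law of the event
`{min_{α ≠ β} |E_α - E_β| < δ}` = `SmallGap γ δ`). Weyl's perturbation theorem for the index-aligned ordered eigenvalues:
R. A. Horn, C. R. Johnson, *Matrix Analysis* (2nd ed. 2013), Cor. 4.3.15; R. Bhatia, *Matrix Analysis* (1997), Cor. III.2.6 —
here DERIVED from the tree's min–max file `Literature.Analysis.InnerProduct.CourantFischerBounds`
(`abs_eigenvalues_sub_eigenvalues_le`), transported to `Matrix.IsHermitian.eigenvalues` along `Matrix.toEuclideanLin`.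

WHAT IS PROVED (audit cell `pub-imbrie`, LLA.md block WF (gen 12); these are AUDIT LEMMAS about the objects of (1.1)/(1.3),
NOT statements of the paper).
* `abs_eigenvalues_sub_eigenvalues_le_opNorm` (any `RCLike 𝕜`, any finite index type): for Hermitian matrices `A, B`,
  `|λ_i(B) - λ_i(A)| ≤ ‖B - A‖` (L²-operator norm, written through `Matrix.toEuclideanCLM`), every index `i`;
  `continuous_eigenvalues_of_continuous_family`: the ordered eigenvalues of a continuous Hermitian family are continuous.
* For the chain (1.1): `continuous_H` (the matrix is entrywise affine in the coupling triple `t = (h, Γ, J)`),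
  `abs_eigs_sub_eigs_le_opNorm` (Weyl for the levels `eigs`), `continuous_eigs`, `continuous_levelDiff`,
  `measurable_levelDiff`, `isOpen_setOf_smallGap` / `measurableSet_setOf_smallGap` (the LLA event (1.3) is an OPEN subset of
  the coupling space — so the probabilities in `LLA`, `A2` are values of the product law on a Borel set, not outer measures of a
  non-measurable set), and `boxMeasure_levelDiff_window_le'` = `ShiftedWindows.boxMeasure_levelDiff_window_le` with its
  measurability hypothesis `hmeas` DISCHARGED: under a linear shift-0 small-gap law for Lebesgue measure on the coupling cube,
  every admissible law family satisfies `P_L (y ≤ |E_q - E_p| ≤ y + η) ≤ ρ₀^(3n+1) · A · (3n+1) · η` for all shifts `y ≥ 0`.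
STATUS: nothing here asserts LLA; Assumption LLA(ν, C) remains an OPEN, UNPROVED hypothesis of [ImbrieJSP2016, Thm 1.1].
No `sorry`, no new axioms.
-/

noncomputable section
open _root_.MeasureTheory Set Filter Matrix
open scoped ENNReal Topology InnerProductSpace

namespace Literature.MathematicalPhysics.QuantumLattice.Imbrie2016

open SmallGapDictionary (Triple)

/-! ### Weyl's perturbation bound and continuity of the ordered eigenvalues of Hermitian matrices -/

section Weyl

variable {𝕜 : Type*} [RCLike 𝕜] {m : Type*} [Fintype m] [DecidableEq m]

/-- [cite: HornJohnson2013, Cor. 4.3.15] **Weyl's perturbation bound** for the index-aligned ordered eigenvalues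
`Matrix.IsHermitian.eigenvalues` of Hermitian matrices: `|λ_i(B) - λ_i(A)| ≤ ‖B - A‖` (L²-operator norm), every `i`.
Derived from the tree's `Literature.Analysis.InnerProduct.abs_eigenvalues_sub_eigenvalues_le` (min–max) and the form bound
`|re ⟪x, (B - A) x⟫| ≤ ‖B - A‖ ‖x‖²` (`abs_re_inner_toEuclideanLin_le`). -/
theorem abs_eigenvalues_sub_eigenvalues_le_opNorm {A B : Matrix m m 𝕜} (hA : A.IsHermitian) (hB : B.IsHermitian)
    (i : m) :
    |hB.eigenvalues i - hA.eigenvalues i| ≤ ‖toEuclideanCLM (n := m) (𝕜 := 𝕜) (B - A)‖ := by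
  have hc : ∀ x : EuclideanSpace 𝕜 m,
      |RCLike.re ⟪(toEuclideanLin B - toEuclideanLin A) x, x⟫_𝕜| ≤
        ‖toEuclideanCLM (n := m) (𝕜 := 𝕜) (B - A)‖ * ‖x‖ ^ 2 := by
    intro x
    have h := Literature.MathematicalPhysics.QuantumLattice.abs_re_inner_toEuclideanLin_le (B - A) x
    rw [inner_re_symm, map_sub] at h
    exact h
  exact Literature.Analysis.InnerProduct.abs_eigenvalues_sub_eigenvalues_le
    (isSymmetric_toEuclideanLin_iff.mpr hA) (isSymmetric_toEuclideanLin_iff.mpr hB) finrank_euclideanSpace hc _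

/-- [cite: HornJohnson2013, Cor. 4.3.15] the identification `Matrix ↦ toEuclideanCLM` is continuous (a linear map out of a
finite-dimensional space). -/
theorem continuous_toEuclideanCLM :
    Continuous fun A : Matrix m m 𝕜 => toEuclideanCLM (n := m) (𝕜 := 𝕜) A := by
  let f : Matrix m m 𝕜 →ₗ[𝕜] (EuclideanSpace 𝕜 m →L[𝕜] EuclideanSpace 𝕜 m) :=
    { toFun := fun A => toEuclideanCLM (n := m) (𝕜 := 𝕜) A
      map_add' := fun A B => map_add _ A B
      map_smul' := fun c A => map_smul _ c A }
  exact f.continuous_of_finiteDimensional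

/-- [cite: HornJohnson2013, Cor. 4.3.15] **continuity of the ordered eigenvalues of a continuous Hermitian family**
(Weyl's bound + continuity of `x ↦ ‖H x - H x₀‖`). -/
theorem continuous_eigenvalues_of_continuous_family {X : Type*} [TopologicalSpace X] {M : X → Matrix m m 𝕜}
    (hM : Continuous M) (hHerm : ∀ x, (M x).IsHermitian) (i : m) :
    Continuous fun x => (hHerm x).eigenvalues i := by
  refine continuous_iff_continuousAt.2 fun x₀ => ?_
  rw [ContinuousAt, tendsto_iff_norm_sub_tendsto_zero]
  have hbound : ∀ x, ‖(hHerm x).eigenvalues i - (hHerm x₀).eigenvalues i‖ ≤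
      ‖toEuclideanCLM (n := m) (𝕜 := 𝕜) (M x - M x₀)‖ := fun x => by
    rw [Real.norm_eq_abs]
    exact abs_eigenvalues_sub_eigenvalues_le_opNorm (hHerm x₀) (hHerm x) i
  have hlim : Tendsto (fun x => ‖toEuclideanCLM (n := m) (𝕜 := 𝕜) (M x - M x₀)‖) (𝓝 x₀) (𝓝 0) := by
    have hc : Continuous fun x => ‖toEuclideanCLM (n := m) (𝕜 := 𝕜) (M x - M x₀)‖ :=
      (continuous_toEuclideanCLM.comp (hM.sub continuous_const)).norm
    have h0 : ‖toEuclideanCLM (n := m) (𝕜 := 𝕜) (M x₀ - M x₀)‖ = 0 := by simp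
    simpa [h0] using hc.tendsto x₀
  exact squeeze_zero (fun x => norm_nonneg _) hbound hlim

end Weyl

/-! ### The chain (1.1): levels continuous in the couplings, the LLA event is open -/

/-- [cite: ImbrieJSP2016, eq. (1.1)] the box Hamiltonian (1.1) is (entrywise affine, hence) continuous in the coupling
triple `t = (h, Γ, J)`. -/
theorem continuous_H (γ : ℝ) (n : ℕ) : Continuous fun t : Triple n => H γ (Params.ofTriple t) := by
  refine continuous_matrix fun σ τ => ?_
  simp only [H, Matrix.add_apply, Matrix.diagonal_apply, Matrix.of_apply, diagEnergy, offDiag, Params.ofTriple]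
  refine Continuous.add ?_ (continuous_finsetSum _ fun i _ => ?_)
  · split_ifs
    · fun_prop
    · exact continuous_const
  · split_ifs
    · fun_prop
    · exact continuous_const

/-- [cite: ImbrieJSP2016, eq. (1.1)] **Weyl for the levels of (1.1)**: `|E_α(p) - E_α(q)| ≤ ‖H(p) - H(q)‖`
(L²-operator norm) for every level index `α` and any two parameter sets. -/
theorem abs_eigs_sub_eigs_le_opNorm (γ : ℝ) {n : ℕ} (p q : Params n) (α : Cfg n) :
    |eigs γ p α - eigs γ q α| ≤ ‖toEuclideanCLM (n := Cfg n) (𝕜 := ℝ) (H γ p - H γ q)‖ :=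
  abs_eigenvalues_sub_eigenvalues_le_opNorm (H_isHermitian γ q) (H_isHermitian γ p) α

/-- [cite: ImbrieJSP2016, eq. (1.1)] each ordered level `E_α` of the box Hamiltonian is a continuous function of the
coupling triple. -/
theorem continuous_eigs (γ : ℝ) (n : ℕ) (α : Cfg n) : Continuous fun t : Triple n => eigs γ (Params.ofTriple t) α :=
  continuous_eigenvalues_of_continuous_family (continuous_H γ n) (fun t => H_isHermitian γ (Params.ofTriple t)) α

/-- [cite: ImbrieJSP2016, eq. (1.1), (1.3)] the level difference `|E_q - E_p|` is continuous in the couplings. -/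
theorem continuous_levelDiff (γ : ℝ) (n : ℕ) (p q : Cfg n) : Continuous (levelDiff γ n p q) :=
  ((continuous_eigs γ n q).sub (continuous_eigs γ n p)).abs

/-- [cite: ImbrieJSP2016, eq. (1.1), (1.3)] the level difference `|E_q - E_p|` is Borel measurable in the couplings
(the hypothesis `hmeas` of `ShiftedWindows.boxMeasure_levelDiff_window_le`). -/
theorem measurable_levelDiff (γ : ℝ) (n : ℕ) (p q : Cfg n) : Measurable (levelDiff γ n p q) :=
  (continuous_levelDiff γ n p q).measurable

/-- [cite: ImbrieJSP2016, eq. (1.3)] the LLA event `{min_{α ≠ β} |E_α - E_β| < δ}` is an OPEN subset of the coupling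
space (a finite union of strict sub-level sets of continuous functions). -/
theorem isOpen_setOf_smallGap (γ δ : ℝ) (n : ℕ) : IsOpen {t : Triple n | SmallGap γ δ (Params.ofTriple t)} := by
  have hset : {t : Triple n | SmallGap γ δ (Params.ofTriple t)} =
      ⋃ α : Cfg n, ⋃ β : Cfg n, ⋃ (_ : α ≠ β),
        {t : Triple n | |eigs γ (Params.ofTriple t) α - eigs γ (Params.ofTriple t) β| < δ} := by
    ext t
    simp only [SmallGap, Set.mem_setOf_eq, Set.mem_iUnion, exists_prop]
  rw [hset]
  exact isOpen_iUnion fun α => isOpen_iUnion fun β => isOpen_iUnion fun _ =>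
    isOpen_lt ((continuous_eigs γ n α).sub (continuous_eigs γ n β)).abs continuous_const

/-- [cite: ImbrieJSP2016, eq. (1.3)] the LLA event is a Borel set of the coupling space. -/
theorem measurableSet_setOf_smallGap (γ δ : ℝ) (n : ℕ) :
    MeasurableSet {t : Triple n | SmallGap γ δ (Params.ofTriple t)} :=
  (isOpen_setOf_smallGap γ δ n).measurableSet

/-- [cite: ImbrieJSP2016, eq. (1.1), p. 1000, eq. (1.3) = (5.2)] **SHIFT-0 ⟹ ALL SHIFTS FOR THE CHAIN (1.1), no proviso**
(pub-imbrie LLA.md WE10 (d) / WF): `ShiftedWindows.boxMeasure_levelDiff_window_le` with its measurability hypothesis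
discharged by `measurable_levelDiff`. Hypotheses: a linear min-gap law at shift `0` for LEBESGUE measure on the coupling cube
(`Leb {t ∈ cube | SmallGap γ δ t} ≤ A δ`, all `δ > 0`), an admissible law family `L` (density bound `ρ₀ ≥ 0`), a pair `p ≠ q`.
Conclusion: for every position `a`, shift `y ≥ 0` and width `η > 0`,
`P_L (y ≤ |E_q - E_p| ≤ y + η) ≤ ρ₀^(3n+1) · A · ((3n+1) η)`. -/
theorem boxMeasure_levelDiff_window_le' {L : Laws} {ρ₀ : ℝ} (hL : L.Admissible ρ₀) (hρ : 0 ≤ ρ₀) (γ : ℝ) (a : ℤ)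
    (n : ℕ) {p q : Cfg n} (hpq : p ≠ q) {A : ℝ} (hA : 0 ≤ A)
    (hgap : ∀ δ : ℝ, 0 < δ →
      volume ({t : Triple n | SmallGap γ δ (Params.ofTriple t)} ∩ cube n) ≤ ENNReal.ofReal (A * δ))
    {y η : ℝ} (hy : 0 ≤ y) (hη : 0 < η) :
    L.boxMeasure a n {t | y ≤ levelDiff γ n p q t ∧ levelDiff γ n p q t ≤ y + η}
      ≤ ENNReal.ofReal (ρ₀ ^ (3 * n + 1) * (A * ((3 * n + 1) * η))) :=
  boxMeasure_levelDiff_window_le hL hρ γ a n hpq (measurable_levelDiff γ n p q) hA hgap hy hη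

end Literature.MathematicalPhysics.QuantumLattice.Imbrie2016
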